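import Literature.AlgebraicGeometry.Motives.AlgPoints
import Literature.AlgebraicGeometry.Motives.SubschemeCycles
import Mathlib.RingTheory.DualNumber
import HarnessLib

/-!
# `ℂ[ε]`-points of a `ℂ`-scheme: the dual numbers as a `ℂ`-scheme, the local homomorphism
# `𝒪_{Y,x₀} → ℂ[ε]` of a `ℂ[ε]`-point and its `ε`-part (a tangent vector), constancy, slice points

Layer `Literature/AlgebraicGeometry/Motives`, namespace `Literature.AlgebraicGeometry.Motives.AbelianVariety` (the
namespace of the M13 programme's SPEC, whose tokens `dualNumberOver`/`dualNumberPoint` this file makes tree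
declarations — every HOME paste site resolves unchanged).  Generic in the `ℂ`-scheme `Y` (no abelian-variety
content despite the namespace).  [GortzWedhorn2020] (6.3)–(6.4): the tangent space `T_x X` of a `k`-scheme at a
`k`-rational point is the set of `k[ε]`-points `Spec k[ε] → X` over `x`, a `k[ε]`-point being a local
`k`-homomorphism `𝒪_{X,x} → k[ε]` whose `ε`-component is a `k`-derivation `𝒪_{X,x} → k`.

* §0 `dualNumberOver` (`Spec ℂ[ε]` over `Spec ℂ`), `dualNumberPoint` (its closed point from the monoidal unit),
  `dualNumberPoint_toUnit` — DEFINITIONS WITH BODIES (the SPEC probe's tokens, verbatim);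
* §1 for `w : dualNumberOver ⟶ Y`: `dualNumberHom`/`dualNumberBasePt`/`dualNumberStalkHom` (abbreviations for
  `w.left`, its base point `x₀`, and Mathlib's `Scheme.stalkClosedPointTo w.left : 𝒪_{Y,x₀} → ℂ[ε]`),
  `specMap_dualNumberStalkHom_comp_fromSpecStalk`, `dualNumberHom_comp_hom`, `scalar_comp_dualNumberStalkHom` /
  `dualNumberStalkHom_germ_scalar` (`w` is a `ℂ`-morphism: scalars go to `c + 0·ε`), `fst_dualNumberStalkHom_eq_zero_iff`
  (`(·).fst = 0 ↔ · ∈ 𝔪_{x₀}`), the LEIBNIZ RULE `snd_dualNumberStalkHom_mul`, `snd_dualNumberStalkHom_eq_zero_of_mem_sq`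
  (the `ε`-part kills `𝔪²`), `snd_dualNumberStalkHom_scalar_mul` (`ℂ`-linearity), `snd_dualNumberStalkHom_germ_scalar`,
  functoriality `dualNumberStalkHom_comp(_germ)` in `ℂ`-morphisms `Y → Y'`;
* §2 CONSTANCY `exists_eq_toUnit_comp_of_snd_eq_zero`: a `ℂ[ε]`-point with zero `ε`-part is constant,
  `w = toUnit ≫ x`; `tensorUnit_hom`, `toUnit_left`;
* §3 `comp_toSpecOver'`, the SLICE POINT `slicePt X P : dualNumberOver ⟶ X ⊗ dualNumberOver` (`(P, ε)` over a
  `ℂ`-point `P`), `slicePt_fst/_snd`, `dualNumberStalkHom_congr`.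

Mathlib searched (pin): `Scheme.stalkClosedPointTo`, `Scheme.Spec_stalkClosedPointTo_fromSpecStalk`,
`Scheme.SpecMap_stalkMap_fromSpecStalk`, `Scheme.stalkClosedPointTo_comp`, `Scheme.Hom.germ_stalkMap`,
`Spec.fromSpecStalk_eq`, `Spec.map_inj`, `isUnit_map_iff`, `TrivSqZeroExt.isUnit_iff_isUnit_fst`, `DualNumber.snd_mul`,
`DualNumber.instIsLocalRing`, `Submodule.mul_induction_on`, `CartesianMonoidalCategory.toUnit_unique` (used); Mathlib
has no scheme-level tangent space as `k[ε]`-points (cf. `Morphisms/StalkOfDualNumberRigid` for the converse reading).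

## References

* U. Görtz, T. Wedhorn, *Algebraic Geometry I: Schemes* (2nd ed., Springer 2020): (6.3)–(6.4) (tangent vectors as
  `k[ε]`-points; derivations), Def. 6.2. [GortzWedhorn2020]
* D. Mumford, *Abelian Varieties* (1970): §13, proof of the Theorem pp. 125–130 (`R`-valued points, `R` local
  Artinian, through a point; the tangent space of `X̂`). [MumfordAV1970]
-/

set_option autoImplicit false

noncomputable section

universe u

open CategoryTheory CategoryTheory.Limits AlgebraicGeometry Topology TopologicalSpace MonoidalCategory
open CartesianMonoidalCategory
open scoped DualNumber
open Literature.AlgebraicGeometry.Motives (AlgPoints SchemeOver)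

namespace Literature.AlgebraicGeometry.Motives.AbelianVariety

/-! ## §0 The carriers: `Spec ℂ[ε]` as a `ℂ`-scheme and its closed point (tokens of the M13 SPEC probe) -/

/-- The dual numbers `Spec ℂ[ε]` as a `ℂ`-scheme (non-Prop plumbing; the M13 SPEC's token). [cite: GortzWedhorn2020, (6.3)–(6.4)] -/
def dualNumberOver : SchemeOver ℂ :=
  Over.mk (Spec.map (CommRingCat.ofHom (algebraMap ℂ ℂ[ε])))

/-- The closed point `Spec ℂ → Spec ℂ[ε]` (`ε ↦ 0`) as a `ℂ`-morphism from the monoidal unit (non-Prop plumbing).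
[cite: GortzWedhorn2020, (6.3)–(6.4)] -/
def dualNumberPoint : 𝟙_ (SchemeOver ℂ) ⟶ dualNumberOver :=
  Over.homMk (Spec.map (CommRingCat.ofHom (TrivSqZeroExt.fstHom ℂ ℂ ℂ).toRingHom)) (by
    change Spec.map _ ≫ Spec.map _ = 𝟙 _
    rw [← Spec.map_comp, ← CommRingCat.ofHom_comp]
    have : (TrivSqZeroExt.fstHom ℂ ℂ ℂ).toRingHom.comp (algebraMap ℂ ℂ[ε]) = RingHom.id ℂ := by
      ext x; simp
    rw [this, CommRingCat.ofHom_id]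
    exact Spec.map_id _)

/-- `Spec ℂ → Spec ℂ[ε] → Spec ℂ` is the identity. [cite: GortzWedhorn2020, (6.3)–(6.4)] -/
theorem dualNumberPoint_toUnit : dualNumberPoint ≫ CartesianMonoidalCategory.toUnit dualNumberOver = 𝟙 _ :=
  Subsingleton.elim _ _

/-! ## §1 A `ℂ[ε]`-point as a local homomorphism `𝒪_{Y,x₀} → ℂ[ε]`; its `ε`-part is a derivation -/

section Point

/-- `ℂ[ε]` (bundled) is a local ring (Mathlib `DualNumber.instIsLocalRing`). [cite: GortzWedhorn2020, (6.3)–(6.4)] -/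
theorem isLocalRing_of_dualNumber : IsLocalRing (CommRingCat.of ℂ[ε]) :=
  inferInstanceAs (IsLocalRing ℂ[ε])


variable {Y : SchemeOver ℂ} (w : dualNumberOver ⟶ Y)

/-- The scheme morphism `Spec ℂ[ε] → Y` underlying a `ℂ[ε]`-point. [folklore] -/
abbrev dualNumberHom : Spec (CommRingCat.of ℂ[ε]) ⟶ Y.left := w.left

/-- The base point `x₀ ∈ Y` of a `ℂ[ε]`-point (image of the closed point of `Spec ℂ[ε]`).
[cite: GortzWedhorn2020, (6.3)–(6.4)] -/
abbrev dualNumberBasePt : Y.left :=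
  (dualNumberHom w).base (IsLocalRing.closedPoint (CommRingCat.of ℂ[ε]))

/-- The local homomorphism `𝒪_{Y,x₀} → ℂ[ε]` of a `ℂ[ε]`-point (Mathlib `Scheme.stalkClosedPointTo`); its
first component is evaluation at `x₀`, its second the tangent vector. [cite: GortzWedhorn2020, (6.3)–(6.4)] -/
abbrev dualNumberStalkHom : Y.left.presheaf.stalk (dualNumberBasePt w) ⟶ CommRingCat.of ℂ[ε] :=
  Scheme.stalkClosedPointTo (dualNumberHom w)

/-- `w = Spec(𝒪_{Y,x₀} → ℂ[ε]) ≫ (Spec 𝒪_{Y,x₀} → Y)`. [cite: GortzWedhorn2020, (6.3)–(6.4)] -/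
theorem specMap_dualNumberStalkHom_comp_fromSpecStalk :
    Spec.map (dualNumberStalkHom w) ≫ Y.left.fromSpecStalk (dualNumberBasePt w) = w.left :=
  Scheme.Spec_stalkClosedPointTo_fromSpecStalk _

/-- The structure morphism of `Spec ℂ[ε]` is that of `w`: `w.left ≫ Y.hom = Spec(ℂ → ℂ[ε])`. [cite: GortzWedhorn2020, (6.3)–(6.4)] -/
theorem dualNumberHom_comp_hom :
    w.left ≫ Y.hom = Spec.map (CommRingCat.ofHom (algebraMap ℂ ℂ[ε])) :=
  Over.w w

/-- **`w` is a `ℂ`-morphism, read on the local homomorphism**: the composite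
`ℂ = Γ(Spec ℂ) → 𝒪_{Spec ℂ, pt} → 𝒪_{Y,x₀} → ℂ[ε]` is the structure map `ℂ → ℂ[ε]`. [cite: GortzWedhorn2020, (6.3)–(6.4)] -/
theorem scalar_comp_dualNumberStalkHom :
    (Scheme.ΓSpecIso (.of ℂ)).inv ≫
        (Spec (.of ℂ)).presheaf.germ ⊤ (Y.hom.base (dualNumberBasePt w)) trivial ≫
      Y.hom.stalkMap (dualNumberBasePt w) ≫ dualNumberStalkHom w =
      CommRingCat.ofHom (algebraMap ℂ ℂ[ε]) := by
  rw [← Spec.map_inj, ← Category.assoc, Spec.map_comp, Spec.map_comp, ← Spec.fromSpecStalk_eq,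
    Category.assoc, Scheme.SpecMap_stalkMap_fromSpecStalk,
    Scheme.Spec_stalkClosedPointTo_fromSpecStalk_assoc]
  exact dualNumberHom_comp_hom w

/-- Germs of scalars along the structure morphism: `germ_{x₀} (Y.hom^* t) = Y.hom.stalkMap (germ_{pt} t)`.
[cite: GortzWedhorn2020, (6.3)–(6.4)] -/
theorem germ_appTop_eq_stalkMap (t : Γ(Spec (.of ℂ), ⊤)) :
    Y.left.presheaf.germ ⊤ (dualNumberBasePt w) trivial (Y.hom.appTop t) =
      Y.hom.stalkMap (dualNumberBasePt w)
        ((Spec (.of ℂ)).presheaf.germ ⊤ (Y.hom.base (dualNumberBasePt w)) trivial t) := by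
  change _ = ((Spec (.of ℂ)).presheaf.germ ⊤ (Y.hom.base (dualNumberBasePt w)) trivial ≫
    Y.hom.stalkMap (dualNumberBasePt w)) t
  rw [Scheme.Hom.germ_stalkMap Y.hom ⊤ (dualNumberBasePt w) trivial]
  rfl

/-- **`ℂ`-compatibility**: the `ℂ[ε]`-point sends the germ of the scalar `c` to `c = c + 0·ε`. [cite: GortzWedhorn2020, (6.3)–(6.4)] -/
theorem dualNumberStalkHom_germ_scalar (c : ℂ) :
    dualNumberStalkHom w (Y.left.presheaf.germ ⊤ (dualNumberBasePt w) trivial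
        (Y.hom.appTop ((Scheme.ΓSpecIso (.of ℂ)).inv c))) = algebraMap ℂ ℂ[ε] c := by
  rw [germ_appTop_eq_stalkMap]
  exact congrArg (fun f : CommRingCat.of ℂ ⟶ CommRingCat.of ℂ[ε] => f.hom c)
    (scalar_comp_dualNumberStalkHom w)

/-- **`(·).fst = 0 ↔ · ∈ 𝔪_{x₀}`**: the first component of `𝒪_{Y,x₀} → ℂ[ε]` is the evaluation
character (the homomorphism is local). [cite: GortzWedhorn2020, (6.3)–(6.4)] -/
theorem fst_dualNumberStalkHom_eq_zero_iff (t : Y.left.presheaf.stalk (dualNumberBasePt w)) :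
    (dualNumberStalkHom w t).fst = 0 ↔
      t ∈ IsLocalRing.maximalIdeal (Y.left.presheaf.stalk (dualNumberBasePt w)) := by
  rw [IsLocalRing.mem_maximalIdeal, mem_nonunits_iff,
    ← isUnit_map_iff (dualNumberStalkHom w).hom t, TrivSqZeroExt.isUnit_iff_isUnit_fst,
    isUnit_iff_ne_zero, not_not]

/-- **Leibniz rule** for the `ε`-part: `D(ab) = a(x₀) D(b) + D(a) b(x₀)`. [cite: GortzWedhorn2020, (6.3)–(6.4)] -/
theorem snd_dualNumberStalkHom_mul (a b : Y.left.presheaf.stalk (dualNumberBasePt w)) :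
    (dualNumberStalkHom w (a * b)).snd =
      (dualNumberStalkHom w a).fst * (dualNumberStalkHom w b).snd +
        (dualNumberStalkHom w a).snd * (dualNumberStalkHom w b).fst := by
  rw [map_mul, DualNumber.snd_mul]

/-- The `ε`-part kills `𝔪_{x₀}²`. [cite: GortzWedhorn2020, (6.3)–(6.4) and Def. 6.2] -/
theorem snd_dualNumberStalkHom_eq_zero_of_mem_sq {t : Y.left.presheaf.stalk (dualNumberBasePt w)}
    (ht : t ∈ IsLocalRing.maximalIdeal (Y.left.presheaf.stalk (dualNumberBasePt w)) ^ 2) :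
    (dualNumberStalkHom w t).snd = 0 := by
  rw [pow_two] at ht
  refine Submodule.mul_induction_on ht (fun a ha b hb => ?_) (fun a b ha hb => ?_)
  · rw [snd_dualNumberStalkHom_mul, (fst_dualNumberStalkHom_eq_zero_iff w a).2 ha,
      (fst_dualNumberStalkHom_eq_zero_iff w b).2 hb, zero_mul, mul_zero, add_zero]
  · rw [map_add, TrivSqZeroExt.snd_add, ha, hb, add_zero]

/-- **`ℂ`-linearity** of the `ε`-part for the scalars of `Y`: `D(c · t) = c · D(t)`. [cite: GortzWedhorn2020, (6.3)–(6.4)] -/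
theorem snd_dualNumberStalkHom_scalar_mul (c : ℂ) (t : Y.left.presheaf.stalk (dualNumberBasePt w)) :
    (dualNumberStalkHom w (Y.left.presheaf.germ ⊤ (dualNumberBasePt w) trivial
        (Y.hom.appTop ((Scheme.ΓSpecIso (.of ℂ)).inv c)) * t)).snd =
      c * (dualNumberStalkHom w t).snd := by
  rw [map_mul, dualNumberStalkHom_germ_scalar, DualNumber.snd_mul, TrivSqZeroExt.algebraMap_eq_inl,
    TrivSqZeroExt.fst_inl, TrivSqZeroExt.snd_inl, zero_mul, add_zero]

/-- The `ε`-part of the germ of a scalar vanishes. [cite: GortzWedhorn2020, (6.3)–(6.4)] -/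
theorem snd_dualNumberStalkHom_germ_scalar (c : ℂ) :
    (dualNumberStalkHom w (Y.left.presheaf.germ ⊤ (dualNumberBasePt w) trivial
        (Y.hom.appTop ((Scheme.ΓSpecIso (.of ℂ)).inv c)))).snd = 0 := by
  rw [dualNumberStalkHom_germ_scalar, TrivSqZeroExt.algebraMap_eq_inl, TrivSqZeroExt.snd_inl]

/-- **Functoriality** (translation bookkeeping for the consumers): the local homomorphism of the image
`w ≫ g` of a `ℂ[ε]`-point under a `ℂ`-morphism `g : Y → Y'` is `𝒪_{Y',g x₀} → 𝒪_{Y,x₀} → ℂ[ε]`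
(Mathlib `Scheme.stalkClosedPointTo_comp`); e.g. `g = t_a` a translation of an abelian variety:
the `ε`-part of `s` at `t_a ∘ w` is the `ε`-part of `t_a^* s` at `w`. [cite: GortzWedhorn2020, (6.3)–(6.4)] -/
theorem dualNumberStalkHom_comp {Y' : SchemeOver ℂ} (g : Y ⟶ Y') :
    dualNumberStalkHom (w ≫ g) = g.left.stalkMap (dualNumberBasePt w) ≫ dualNumberStalkHom w :=
  Scheme.stalkClosedPointTo_comp w.left g.left

/-- Functoriality on germs: `(w ≫ g)(germ_{g x₀} s) = w(germ_{x₀} (g^* s))`. [cite: GortzWedhorn2020, (6.3)–(6.4)] -/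
theorem dualNumberStalkHom_comp_germ {Y' : SchemeOver ℂ} (g : Y ⟶ Y') (U : Y'.left.Opens)
    (hU : dualNumberBasePt (w ≫ g) ∈ U) (s : Γ(Y'.left, U)) :
    dualNumberStalkHom (w ≫ g) (Y'.left.presheaf.germ U (dualNumberBasePt (w ≫ g)) hU s) =
      dualNumberStalkHom w (Y.left.presheaf.germ (g.left ⁻¹ᵁ U) (dualNumberBasePt w) hU (g.left.app U s)) := by
  rw [dualNumberStalkHom_comp]
  change ((Y'.left.presheaf.germ U (g.left.base (dualNumberBasePt w)) hU ≫
    g.left.stalkMap (dualNumberBasePt w)) ≫ dualNumberStalkHom w) s = _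
  rw [Scheme.Hom.germ_stalkMap g.left U (dualNumberBasePt w) hU]
  rfl

end Point

/-! ## §2 Constancy: a `ℂ[ε]`-point with zero derivation is constant -/

section Constancy

variable {Y : SchemeOver ℂ} (w : dualNumberOver ⟶ Y)

/-- The structure morphism of the monoidal unit `𝟙 = (Spec ℂ, 𝟙)` of `SchemeOver ℂ`. [cite: GortzWedhorn2020, (6.3)–(6.4)] -/
theorem tensorUnit_hom : (𝟙_ (SchemeOver ℂ)).hom = 𝟙 (Spec (.of ℂ)) := rfl

/-- `(toUnit S).left = S.hom`. [cite: GortzWedhorn2020, (6.3)–(6.4)] -/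
theorem toUnit_left (S : SchemeOver ℂ) : (CartesianMonoidalCategory.toUnit S).left = S.hom := by
  simp

/-- **CONSTANCY CRITERION.**  If the `ε`-part of `𝒪_{Y,x₀} → ℂ[ε]` vanishes identically, the `ℂ[ε]`-point
`w` is CONSTANT: `w = toUnit ≫ x` for the `ℂ`-point `x = w|_{ε = 0}` — the conclusion form of B-p19's
`socket_N3d_core_lieKTheta`. [cite: GortzWedhorn2020, (6.3)–(6.4)] [cite: MumfordAV1970, §13 (proof of the Thm. pp. 125–130)] -/
theorem exists_eq_toUnit_comp_of_snd_eq_zero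
    (h : ∀ t : Y.left.presheaf.stalk (dualNumberBasePt w), (dualNumberStalkHom w t).snd = 0) :
    ∃ x : 𝟙_ (SchemeOver ℂ) ⟶ Y, w = CartesianMonoidalCategory.toUnit _ ≫ x := by
  -- the evaluation character `ψ : 𝒪_{Y,x₀} → ℂ` and the factorisation `φ_w = inl ∘ ψ`
  let ψ : Y.left.presheaf.stalk (dualNumberBasePt w) ⟶ CommRingCat.of ℂ :=
    dualNumberStalkHom w ≫ CommRingCat.ofHom (TrivSqZeroExt.fstHom ℂ ℂ ℂ).toRingHom
  have hfac : dualNumberStalkHom w = ψ ≫ CommRingCat.ofHom (algebraMap ℂ ℂ[ε]) := by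
    apply CommRingCat.hom_ext
    apply RingHom.ext
    intro t
    refine TrivSqZeroExt.ext ?_ ?_
    · change _ = (algebraMap ℂ ℂ[ε] ((dualNumberStalkHom w t).fst)).fst
      rw [TrivSqZeroExt.algebraMap_eq_inl, TrivSqZeroExt.fst_inl]
    · change _ = (algebraMap ℂ ℂ[ε] ((dualNumberStalkHom w t).fst)).snd
      rw [TrivSqZeroExt.algebraMap_eq_inl, TrivSqZeroExt.snd_inl]
      exact h t
  -- the scalar compatibility of `ψ`: `ℂ → 𝒪_{Spec ℂ,pt} → 𝒪_{Y,x₀} → ℂ` is the identity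
  have hψ : (Scheme.ΓSpecIso (.of ℂ)).inv ≫
      (Spec (.of ℂ)).presheaf.germ ⊤ (Y.hom.base (dualNumberBasePt w)) trivial ≫
        Y.hom.stalkMap (dualNumberBasePt w) ≫ ψ = 𝟙 _ := by
    change _ ≫ _ ≫ _ ≫ dualNumberStalkHom w ≫ _ = _
    rw [reassoc_of% (scalar_comp_dualNumberStalkHom w), ← CommRingCat.ofHom_comp]
    have : (TrivSqZeroExt.fstHom ℂ ℂ ℂ).toRingHom.comp (algebraMap ℂ ℂ[ε]) = RingHom.id ℂ := by
      ext x; simp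
    rw [this]
    rfl
  -- the constant point `x = Spec ψ ≫ (Spec 𝒪_{Y,x₀} → Y)` over `ℂ`
  have hx : (Spec.map ψ ≫ Y.left.fromSpecStalk (dualNumberBasePt w)) ≫ Y.hom = 𝟙 _ := by
    rw [Category.assoc, ← Scheme.SpecMap_stalkMap_fromSpecStalk, Spec.fromSpecStalk_eq,
      ← Spec.map_comp_assoc, ← Spec.map_comp]
    simp only [Category.assoc]
    rw [hψ, Spec.map_id]
  refine ⟨Over.homMk (Spec.map ψ ≫ Y.left.fromSpecStalk (dualNumberBasePt w))
    (by rw [tensorUnit_hom]; exact hx), ?_⟩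
  ext : 1
  rw [Over.comp_left, toUnit_left]
  change w.left = Spec.map (CommRingCat.ofHom (algebraMap ℂ ℂ[ε])) ≫ Spec.map ψ ≫
    Y.left.fromSpecStalk (dualNumberBasePt w)
  rw [← specMap_dualNumberStalkHom_comp_fromSpecStalk w, hfac, Spec.map_comp, Category.assoc]

end Constancy

/-! ## §3 The slice point `(P, ε)` of `X × Spec ℂ[ε]` over a `ℂ`-point `P` -/

section Slice

variable (X : SchemeOver ℂ)

/-- The structure morphism to `specOver ℂ ℂ` is natural: `f ≫ toSpecOver Y = toSpecOver X` (file-local copy of ★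
`Motives.AbelianVariety.comp_toSpecOver_eq'` of `AbelianVarietyKummerBound`, not imported here). [folklore] -/
private theorem comp_toSpecOver' {Y : SchemeOver ℂ} (f : X ⟶ Y) : f ≫ toSpecOver Y = toSpecOver X := by
  apply Over.OverMorphism.ext
  change f.left ≫ Y.hom = X.hom
  exact Over.w f

/-- **The slice point `(P, ε) : Spec ℂ[ε] → X × Spec ℂ[ε]`** over a `ℂ`-point `P` of `X` (the pairing of the
constant point `Spec ℂ[ε] → Spec ℂ → X` with the identity). Non-Prop plumbing. [cite: GortzWedhorn2020, (6.3)–(6.4)] -/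
def slicePt (P : AlgPoints X ℂ) : dualNumberOver ⟶ X ⊗ dualNumberOver :=
  lift (toSpecOver dualNumberOver ≫ P) (𝟙 _)

/-- First projection of the slice point: the constant point at `P`. [cite: GortzWedhorn2020, (6.3)–(6.4)] -/
@[simp] theorem slicePt_fst (P : AlgPoints X ℂ) : slicePt X P ≫ fst _ _ = toSpecOver dualNumberOver ≫ P :=
  lift_fst _ _

/-- Second projection of the slice point: the identity of `Spec ℂ[ε]`. [cite: GortzWedhorn2020, (6.3)–(6.4)] -/
@[simp] theorem slicePt_snd (P : AlgPoints X ℂ) : slicePt X P ≫ snd _ _ = 𝟙 _ :=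
  lift_snd _ _

variable {X}

/-- Transport of the read-out along an equality of `ℂ[ε]`-points (the stalk depends on the point, so this
is stated on germs of a fixed section). [cite: GortzWedhorn2020, (6.3)–(6.4)] -/
theorem dualNumberStalkHom_congr {w₁ w₂ : dualNumberOver ⟶ X} (h : w₁ = w₂) (U : X.left.Opens)
    (h₁ : dualNumberBasePt w₁ ∈ U) (h₂ : dualNumberBasePt w₂ ∈ U) (s : Γ(X.left, U)) :
    dualNumberStalkHom w₁ (X.left.presheaf.germ U _ h₁ s) = dualNumberStalkHom w₂ (X.left.presheaf.germ U _ h₂ s) := by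
  subst h
  rfl

end Slice

end Literature.AlgebraicGeometry.Motives.AbelianVariety

end
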